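import Literature.Analysis.Calculus.CoordinateJets
import HarnessLib

/-!
# Coordinate jets of directional derivatives

Continuation of `Literature/Analysis/Calculus/CoordinateJets.lean` (pure calculus, everything
proved, no named facts).  There `hasFDerivAt_cjetOf_apply` computes the derivative of the
coordinate jet map along a basis direction as `∂_{e_{i₀}} cjet_m u (y) = ins i₀ (cjet_{m+1} u(y))`,
the new direction entering in the LAST slot of each `D^{j+1}u(y)`.  Since the last slot of
Mathlib's `iteratedFDeriv` is the innermost derivative (`iteratedFDeriv_succ_apply_right`),
this is literally the coordinate `m`-jet of the directional derivative `∂_{e_{i₀}} u`: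

* `CJet.ins_cjetOf_succ`: `ins i₀ (cjet_{m+1} u (y)) = cjet_m (∂_{e_{i₀}} u) (y)` for `u` of
  class `C^{m+1}` at `y`;
* `fderiv_cjetOf_apply_basis`: `∂_{e_{i₀}} (cjet_m u) (y) = cjet_m (∂_{e_{i₀}} u) (y)`, i.e. taking
  coordinate jets commutes with directional differentiation;
* `fderiv_comp_prod_cjetOf`: the chain rule for `z ↦ H(c(z), cjet_m u(z))` along `e_{i₀}`, with a
  differentiable coefficient map `c` into a parameter space;
* `fderiv_apply_eq_zero_of_comp_prod_cjetOf`: an equation `H(c(y), cjet_m u(y)) = 0` on an open set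
  differentiates to `DH(c(y), cjet_m u(y)) · (∂_{e_{i₀}} c(y), cjet_m (∂_{e_{i₀}} u)(y)) = 0` there.

This is the form in which a fully nonlinear equation is differentiated once in the
difference-quotient regularity argument (Gilbarg–Trudinger 2001, §17.4 and Lemma 17.16): the
directional derivative `∂_{e_{i₀}} u` solves the linearised equation, whose coefficients are
jet-derivatives of `H` along the solution.  Compared with `CoordinateJetsTD.lean` (total
derivative `TD` of a function of `(y, θ, jet)` with a constant parameter `θ`), the parameter here
is an arbitrary differentiable function `c` of the point and the result is expressed through the
jet of `∂_{e_{i₀}} u` rather than through `cjet_{m+1} u`.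

## References

* D. Gilbarg, N. S. Trudinger, *Elliptic Partial Differential Equations of Second Order*,
  Classics in Mathematics, Springer 2001, §17.4 and Lemma 17.16. [GilbargTrudinger2001]
-/

noncomputable section

open scoped ContDiff Topology
open Set Function

namespace Literature.Analysis.Calculus

variable {ι : Type*} [Fintype ι] {E : Type*} [NormedAddCommGroup E] [InnerProductSpace ℝ E]
variable {P : Type*} [NormedAddCommGroup P] [NormedSpace ℝ P]

/-- Directional differentiation commutes with iterated derivatives evaluated on fixed vectors:
`Dʲ(∂_e u)(y)(w) = D^{j+1}u(y)(w, e)` for `u` of class `C^{j+1}` at `y` (the last slot of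
`iteratedFDeriv` is the innermost derivative, `iteratedFDeriv_succ_apply_right`, and evaluation
at `e` is a continuous linear map, `ContinuousLinearMap.iteratedFDeriv_comp_left`). [folklore] -/
theorem iteratedFDeriv_fderiv_apply_eq_snoc {u : E → ℝ} {y : E} {j : ℕ}
    (hu : ContDiffAt ℝ (j + 1 : ℕ) u y) (w : Fin j → E) (e : E) :
    iteratedFDeriv ℝ j (fun z => fderiv ℝ u z e) y w =
      iteratedFDeriv ℝ (j + 1) u y (Fin.snoc w e) := by
  rw [iteratedFDeriv_succ_apply_right, Fin.init_snoc, Fin.snoc_last]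
  have hf : ContDiffAt ℝ (j : ℕ) (fderiv ℝ u) y := hu.fderiv_right (by norm_cast)
  have h := ContinuousLinearMap.iteratedFDeriv_comp_left
    (ContinuousLinearMap.apply ℝ ℝ e) hf (i := j) le_rfl
  have hcomp : ((ContinuousLinearMap.apply ℝ ℝ e) ∘ fderiv ℝ u) = fun z => fderiv ℝ u z e := by
    funext z
    rfl
  rw [hcomp] at h
  rw [h]
  rfl

/-- **Key identity**: inserting `i₀` into the `(m+1)`-jet of `u` gives the `m`-jet of the
directional derivative `∂_{e_{i₀}} u`, for `u` of class `C^{m+1}` at `y`: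
`ins i₀ (cjet_{m+1} u (y)) = cjet_m (z ↦ Du(z) e_{i₀}) (y)`. [folklore] -/
theorem CJet.ins_cjetOf_succ (bE : OrthonormalBasis ι ℝ E) {m : ℕ} (i₀ : ι) {u : E → ℝ} {y : E}
    (hu : ContDiffAt ℝ (m + 1 : ℕ) u y) :
    CJet.ins ι m i₀ (cjetOf bE (m + 1) u y) = cjetOf bE m (fun z => fderiv ℝ u z (bE i₀)) y := by
  funext j I
  rw [CJet.ins_apply, cjetOf_apply, cjetOf_apply]
  have hs : (fun k : Fin ((j : ℕ) + 1) => bE (Fin.snoc (α := fun _ => ι) I i₀ k)) =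
      Fin.snoc (α := fun _ => E) (fun k => bE (I k)) (bE i₀) := Fin.comp_snoc bE I i₀
  have hj : ContDiffAt ℝ ((j : ℕ) + 1 : ℕ) u y :=
    hu.of_le (by exact_mod_cast Nat.succ_le_of_lt j.isLt)
  show iteratedFDeriv ℝ ((j : ℕ) + 1) u y (fun k => bE (Fin.snoc (α := fun _ => ι) I i₀ k)) = _
  rw [hs, iteratedFDeriv_fderiv_apply_eq_snoc hj]

/-- **Coordinate jets commute with directional derivatives**: for `u` of class `C^{m+1}` at `y`,
`∂_{e_{i₀}} (cjet_m u) (y) = cjet_m (∂_{e_{i₀}} u) (y)`. [folklore] -/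
theorem fderiv_cjetOf_apply_basis (bE : OrthonormalBasis ι ℝ E) {m : ℕ} {u : E → ℝ} {y : E}
    (hu : ContDiffAt ℝ (m + 1 : ℕ) u y) (i₀ : ι) :
    fderiv ℝ (cjetOf bE m u) y (bE i₀) = cjetOf bE m (fun z => fderiv ℝ u z (bE i₀)) y := by
  rw [(hasFDerivAt_cjetOf_apply bE hu).2 i₀, CJet.ins_cjetOf_succ bE i₀ hu]

/-- **Chain rule along a basis direction** for `z ↦ H(c(z), cjet_m u(z))`, `c` a differentiable
coefficient map and `u` of class `C^{m+1}` at `y`: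
`∂_{e_{i₀}} [H(c, cjet_m u)](y) = DH(c(y), cjet_m u(y)) · (Dc(y) e_{i₀}, cjet_m (∂_{e_{i₀}} u)(y))`.
[folklore] -/
theorem fderiv_comp_prod_cjetOf (bE : OrthonormalBasis ι ℝ E) {m : ℕ} {H : P × CJet ι m → ℝ}
    {c : E → P} {u : E → ℝ} {y : E} (hH : DifferentiableAt ℝ H (c y, cjetOf bE m u y))
    (hc : DifferentiableAt ℝ c y) (hu : ContDiffAt ℝ (m + 1 : ℕ) u y) (i₀ : ι) :
    fderiv ℝ (fun z => H (c z, cjetOf bE m u z)) y (bE i₀) =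
      fderiv ℝ H (c y, cjetOf bE m u y)
        (fderiv ℝ c y (bE i₀), cjetOf bE m (fun z => fderiv ℝ u z (bE i₀)) y) := by
  obtain ⟨hd, -⟩ := hasFDerivAt_cjetOf_apply bE hu
  have hφ : HasFDerivAt (fun z => (c z, cjetOf bE m u z))
      ((fderiv ℝ c y).prod (fderiv ℝ (cjetOf bE m u) y)) y :=
    hc.hasFDerivAt.prodMk hd.hasFDerivAt
  have hcomp : HasFDerivAt (fun z => H (c z, cjetOf bE m u z))
      ((fderiv ℝ H (c y, cjetOf bE m u y)).comp
        ((fderiv ℝ c y).prod (fderiv ℝ (cjetOf bE m u) y))) y :=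
    hH.hasFDerivAt.comp y hφ
  rw [hcomp.fderiv, ContinuousLinearMap.comp_apply, ContinuousLinearMap.prod_apply,
    fderiv_cjetOf_apply_basis bE hu i₀]

/-- **Differentiating an equation once**: if `H(c(y), cjet_m u(y)) = 0` on an open set `O`, with
`H` differentiable along the graph, `c` differentiable and `u` of class `C^{m+1}` on `O`, then
`DH(c(y), cjet_m u(y)) · (Dc(y) e_{i₀}, cjet_m (∂_{e_{i₀}} u)(y)) = 0` on `O` — the directional
derivative `∂_{e_{i₀}} u` solves the linearised equation (Gilbarg–Trudinger 2001, §17.4).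
[folklore] -/
theorem fderiv_apply_eq_zero_of_comp_prod_cjetOf (bE : OrthonormalBasis ι ℝ E) {m : ℕ}
    {H : P × CJet ι m → ℝ} {c : E → P} {u : E → ℝ} {O : Set E} (hO : IsOpen O)
    (hH : ∀ y ∈ O, DifferentiableAt ℝ H (c y, cjetOf bE m u y))
    (hc : DifferentiableOn ℝ c O) (hu : ContDiffOn ℝ (m + 1 : ℕ) u O)
    (h0 : ∀ y ∈ O, H (c y, cjetOf bE m u y) = 0) (i₀ : ι) :
    ∀ y ∈ O, fderiv ℝ H (c y, cjetOf bE m u y)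
      (fderiv ℝ c y (bE i₀), cjetOf bE m (fun z => fderiv ℝ u z (bE i₀)) y) = 0 := by
  intro y hy
  rw [← fderiv_comp_prod_cjetOf bE (hH y hy) (hc.differentiableAt (hO.mem_nhds hy))
    (hu.contDiffAt (hO.mem_nhds hy)) i₀]
  have hev : (fun z => H (c z, cjetOf bE m u z)) =ᶠ[𝓝 y] fun _ => (0 : ℝ) :=
    Filter.eventually_of_mem (hO.mem_nhds hy) fun z hz => h0 z hz
  rw [hev.fderiv_eq]
  simp

end Literature.Analysis.Calculus
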